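import Summits.AnomalousDissipation.AnomalousDissipation.Theorems.BaireTransferRobustLoudUpgradeLine
import Summits.AnomalousDissipation.AnomalousDissipation.Theorems.BaireTransferRobustLoudUpgradeLineLeaf
import Summits.AnomalousDissipation.AnomalousDissipation.Theorems.BaireTransferRobustLoudUpgradeStubSteadyPersist
import Summits.AnomalousDissipation.AnomalousDissipation.Theorems.BaireTransferRobustLoudUpgradeStubSteadyWindow
import Summits.AnomalousDissipation.AnomalousDissipation.Theorems.BaireTransferRobustLoudUpgradeStubCensusInterior
import Summits.AnomalousDissipation.AnomalousDissipation.Theorems.BaireTransferRobustLoudUpgradeStubMalkinBordered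
import Summits.AnomalousDissipation.AnomalousDissipation.Theorems.BaireTransferRobustLoudUpgradeStubBorderedCone
import Summits.AnomalousDissipation.AnomalousDissipation.Theorems.BaireTransferRobustLoudUpgradeStubPeriodicWindow
import Summits.AnomalousDissipation.AnomalousDissipation.Theorems.BaireTransferRobustLoudUpgradeStubSteadyPersistLeaf
import Summits.AnomalousDissipation.AnomalousDissipation.Theorems.BaireTransferRobustLoudUpgradeStubSteadyWindowLeaf
import Summits.AnomalousDissipation.AnomalousDissipation.Theorems.BaireTransferRobustLoudUpgradeSmallDataCensus
import Summits.AnomalousDissipation.AnomalousDissipation.Theorems.BaireTransferRobustLoudUpgradeLinPeriodicSolBasics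
import Summits.AnomalousDissipation.AnomalousDissipation.Theorems.BaireTransferRobustLoudUpgradePeriodicPersistOfHenry

/-!
# Line `malkin-cone-group-orbits` — LEAD'S skeleton v5 (lead generation 1) for the crux
`BaireTransfer.RobustLoudUpgrade` (stmt-AnomalousDissipation-1144)

Crux (fixed, by name): `∃ S₀ ∀ S ⊇ S₀ ∀ E ε, 0 < ε → ∀ j, LOUD_j(S,E,ε) ⊆ closure (interior LOUD_j(S,2E,ε/2))`.

State inherited from v4 (generation-0 lead): every upgrade theorem of the maximal tame union `tameLeaf` is LANDED
(Theorems/BaireTransferRobustLoudUpgrade*.lean, p72483 … p93076); v4 had ONE sorry, the residual `stub_tameDenseLeaf`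
(`loud ⊆ closure tameLeaf(2E, ε/2)`), honestly crux-sized.

RESHAPE v5 (this lead).  The Disproof's VERDICT ((K-window), (K-lit), §6(vi) of generation 2) isolates the only conceivable
obstruction to the crux at a STEADY loud witness: an all-directions ISOLA CENTRE.  Everything short of it is persistence, and
the tree already holds the analytic tool with NO symmetry hypothesis: `Literature.Analysis.Calculus.malkin_implicit` (bordering
lemma + IFT at a simply degenerate zero with one first-order-visible unfolding direction).  v5 therefore adds ONE new tame class
and its two-step upgrade, both registered as Pi-form stubs independent of any new vocabulary:

* `simpleSteady`  — a mean-zero classical steady witness `u₀` with STRICT budgets which is (i) ISOLATED among the mean-zero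
  steady states of its own force at its own viscosity (in `H¹`), (ii) SIMPLY degenerate or nondegenerate-with-visible-direction:
  the classical mean-zero kernel of `L(ν,u₀)` lies on the complex line of ONE real field `v`, and (iii) some `d ∈ P_S` is
  first-order VISIBLE, `f_d ∉ range L(ν,u₀)`.  No symmetry, no transversality, no sign/index condition: folds, cusps and
  pitchforks IN THE FORCE are all in the class.
* `familySteady` — the interface: a continuous correction `σ(c', x)` of the force along `d`, parametrised by the force AND a
  kernel coordinate `x`, with `σ(c,0) = 0`, every corrected force `f_{c' − σ(c',x) d}` carrying a steady state with budgets, and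
  `x ↦ σ(c, x)` NOT identically zero near `0`.
* `stub_borderedFamily` (analytic, Pi-form; = `exists_bordered_correction` of …StubMalkinBorderedA with the Goldstone vector
  replaced by an arbitrary real kernel field `v` and the phase condition `φ(υ − u₀) = x` instead of `= 0`) ⟹
  `simpleSteady ⊆ familySteady` (glue below: strict-slack window + isolation ⇒ non-constancy);
* `stub_familyBand` (pure topology, Pi-form; the BAND ENGINE — region between two continuous graphs + IVT, the non-symmetric
  twin of the cone engine `mem_closure_interior_of_cone`) ⟹ `familySteady ⊆ closure (interior loud)` (glue below);
* `stub_tameDenseSimple` — the residual, now over `tameLeaf ∪ simpleSteady` (WEAKER than v4's `stub_tameDenseLeaf`).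

After v5 the steady part of the residual is confined to: INVISIBLE simple degeneracies (cokernel ⊥ F_S), kernels of
dimension ≥ 2, and non-symmetric continua of steady states of one force; the periodic part enters through `persistPeriodic`.
Disproof.lean honoured as in v2–v4 (0 < ε carried by the residual; strict budgets; P_S for every S; level decoration; phase
invariance); its VERDICT names no stub of this line as false.
-/

set_option linter.dupNamespace false

noncomputable section

open scoped BigOperators Topology
open Filter Set Function TopologicalSpace MeasureTheory

namespace Summit.AnomalousDissipation.AnomalousDissipation.Cruxes.RobustLoudUpgrade.MalkinConeGroupOrbits

open Literature.Analysis.FunctionSpaces Literature.Analysis.FunctionSpaces.Torus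
open Literature.Analysis.FluidPDE
open Summit.AnomalousDissipation.AnomalousDissipation.Theses.BaireTransfer
open Summit.AnomalousDissipation.AnomalousDissipation.Theorems.RobustLoudUpgrade

/-- The flat unit torus `T³`. -/
local notation "𝕋³" => UnitAddTorus (Fin 3)
/-- Real velocity values. -/
local notation "ℝ³" => EuclideanSpace ℝ (Fin 3)

/-- Sanity: the imported vocabulary is the crux's (definitional). [folklore] -/
example :
    RobustLoudUpgrade ↔
      ∃ S₀ : Finset (Fin 3 → ℤ), ∀ S : Finset (Fin 3 → ℤ), S₀ ⊆ S → ∀ (E ε : ℝ), 0 < ε →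
        ∀ j : ℕ, loud S (1 / ((j : ℝ) + 1)) E ε ⊆
          closure (interior (loud S (1 / ((j : ℝ) + 1)) (2 * E) (ε / 2))) :=
  Iff.rfl

/-! ## §1 Reshape v5: isolated simply-degenerate visible steady witnesses, and the bordered-family interface -/

/-- **Isolated, simply-degenerate, visible loud steady witnesses** (reshape v5).  `c` carries, at some `ν ∈ (0,a)`, a
mean-zero classical steady state `u₀` of `NS_ν(f_c)` with strict budgets which is ISOLATED in `H¹` among the mean-zero
classical steady states of the same force at the same viscosity, whose classical mean-zero kernel lies on the complex line of
one smooth divergence-free mean-zero REAL field `v`, and for which one `d ∈ P_S` is first-order visible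
(`f_d ∉ range L(ν,u₀)`).  (Chow–Hale 1982 Ch. 6; Vanderbauwhede 1982 §8.5; no symmetry asked.) [folklore] -/
def simpleSteady (S : Finset (Fin 3 → ℤ)) (a E ε : ℝ) : Set (Coeff S) :=
  {c | ∃ ν : ℝ, 0 < ν ∧ ν < a ∧ ∃ (u₀ : 𝕋³ → ℝ³) (p₀ : 𝕋³ → ℝ),
    Torus.IsSteadyNSState ν (force S c) u₀ p₀ ∧ HasZeroMean u₀ ∧ meanEnergy (fun _ : ℝ => u₀) < E ∧
      ε < meanDissipation ν (fun _ : ℝ => u₀) ∧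
      (∃ ρ : ℝ, 0 < ρ ∧ ∀ (u' : 𝕋³ → ℝ³) (p' : 𝕋³ → ℝ), Torus.IsSteadyNSState ν (force S c) u' p' →
        HasZeroMean u' → h1DistSq u' u₀ < ρ → u' = u₀) ∧
      ∃ (v : 𝕋³ → ℝ³) (d : Coeff S), IsSmooth v ∧ IsDivFree v ∧ HasZeroMean v ∧
        (∀ w, Torus.LinNSResolventRel ν u₀ 0 w 0 → ∃ z : ℂ, w = z • cplx v) ∧
        ∀ w, ¬ Torus.LinNSResolventRel ν u₀ 0 w (cplx (force S d))}

/-- **Bordered-family steady persistence** (the interface of reshape v5).  At ONE viscosity `ν ∈ (0,a)` there are a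
direction `d ∈ P_S` and a real correction `σ(c', x)` of the force along `d`, defined near `(c, 0)` in `P_S × ℝ`, continuous,
with `σ(c, 0) = 0`, such that every corrected force `f_{c' − σ(c',x) d}` carries a classical steady state with budgets
`≤ E`, `≥ ε`, and `x ↦ σ(c, x)` is NOT identically zero on any neighbourhood of `0`.  (What the bordered implicit function
theorem with a free kernel coordinate delivers at an isolated simply-degenerate visible steady state.) [folklore] -/
def familySteady (S : Finset (Fin 3 → ℤ)) (a E ε : ℝ) : Set (Coeff S) :=
  {c | ∃ ν : ℝ, 0 < ν ∧ ν < a ∧ ∃ (d : Coeff S) (σ : Coeff S × ℝ → ℝ) (r₀ : ℝ), σ (c, 0) = 0 ∧ 0 < r₀ ∧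
    ContinuousOn σ (Metric.ball (c, (0 : ℝ)) r₀) ∧
    (∀ q ∈ Metric.ball (c, (0 : ℝ)) r₀, ∃ (u' : 𝕋³ → ℝ³) (p' : 𝕋³ → ℝ),
      Torus.IsSteadyNSState ν (force S (q.1 - σ q • d)) u' p' ∧
        meanEnergy (fun _ : ℝ => u') ≤ E ∧ ε ≤ meanDissipation ν (fun _ : ℝ => u')) ∧
    ∀ η : ℝ, 0 < η → ∃ x : ℝ, |x| < η ∧ σ (c, x) ≠ 0}

/-! ## §2 The registered stubs of v5 -/

/-- **stub_borderedFamily** (analytic; Pi-form; OPEN — wave 1).  The bordered steady implicit function theorem with a FREE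
KERNEL COORDINATE at a simply-degenerate steady state with one visible force direction: `exists_bordered_correction` of
`…StubMalkinBorderedA` with the Goldstone vector replaced by an arbitrary smooth divergence-free mean-zero real field `v`
spanning the classical kernel, and the phase condition `φ(υ − u₀) = x` (so `υ ≠ u₀` when `x ≠ 0`); the abstract input is
`Literature.Analysis.Calculus.malkin_implicit` / `bordered_implicit` run with parameter space `P_S × ℝ`. [folklore] -/
theorem stub_borderedFamily :
    ∀ (S : Finset (Fin 3 → ℤ)) (c d : Coeff S) (ν : ℝ) (u₀ : UnitAddTorus (Fin 3) → EuclideanSpace ℝ (Fin 3)) (p₀ : UnitAddTorus (Fin 3) → ℝ) (v : UnitAddTorus (Fin 3) → EuclideanSpace ℝ (Fin 3)),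
      0 < ν → Torus.IsSteadyNSState ν (force S c) u₀ p₀ → HasZeroMean u₀ →
      IsSmooth v → IsDivFree v → HasZeroMean v →
      (∀ w, Torus.LinNSResolventRel ν u₀ 0 w 0 → ∃ z : ℂ, w = z • cplx v) →
      (∀ w, ¬ Torus.LinNSResolventRel ν u₀ 0 w (cplx (force S d))) →
      ∃ σ : Coeff S × ℝ → ℝ, σ (c, 0) = 0 ∧ ∀ δ : ℝ, 0 < δ → ∃ r : ℝ, 0 < r ∧
        ContinuousOn σ (Metric.ball (c, (0 : ℝ)) r) ∧
        ∀ q ∈ Metric.ball (c, (0 : ℝ)) r, ∃ (u' : UnitAddTorus (Fin 3) → EuclideanSpace ℝ (Fin 3)) (p' : UnitAddTorus (Fin 3) → ℝ),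
          Torus.IsSteadyNSState ν (force S (q.1 - σ q • d)) u' p' ∧ HasZeroMean u' ∧ h1DistSq u' u₀ < δ ∧
            (q.2 ≠ 0 → u' ≠ u₀) := by
  sorry

/-- **stub_familyBand** (pure topology; Pi-form; OPEN — wave 1).  THE BAND ENGINE: if the corrected points `c' − σ(c',x) d`
are good for `(c', x)` near `(c, 0)`, `σ` is continuous there with `σ(c,0) = 0`, and `x ↦ σ(c,x)` is not identically zero
near `0`, then `c ∈ closure (interior GOOD)` — by the intermediate value theorem the good set contains the open band between
two continuous graphs over a ball of forces, at distance `O(sup |σ(c,·)|) → 0` from `c`. [folklore] -/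
theorem stub_familyBand :
    ∀ (S : Finset (Fin 3 → ℤ)) (A : Set (Coeff S)) (c d : Coeff S) (σ : Coeff S × ℝ → ℝ) (r : ℝ),
      0 < r → σ (c, 0) = 0 → ContinuousOn σ (Metric.ball (c, (0 : ℝ)) r) →
      (∀ q ∈ Metric.ball (c, (0 : ℝ)) r, q.1 - σ q • d ∈ A) →
      (∀ η : ℝ, 0 < η → ∃ x : ℝ, |x| < η ∧ σ (c, x) ≠ 0) →
      c ∈ closure (interior A) := by
  sorry

/-- **stub_tameDenseSimple** (the RESIDUAL BET of the line, reshape v5; HARDEST; held by the lead; OPEN).  With the unit stock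
in `S`, every loud force is a limit in `P_S` of forces carrying a TAME relaxed-loud witness of `tameLeaf ∪ simpleSteady` at
budgets `(2E, ε/2)`.  WEAKER than v4's `stub_tameDenseLeaf`.  WHY IT IS STILL CRUX-SIZED: near a loud force whose every steady
witness is an all-directions isola centre (invisible cokernel + index zero), has a multiple kernel, or sits on a non-symmetric
continuum, and near a loud force with only genuinely time-periodic degenerate witnesses, no persistence theorem applies
(Kupka–Smale for NS in a finite force family is open; grounder g16-16; Disproof VERDICT (K-window)). [folklore] -/
theorem stub_tameDenseSimple :
    ∀ S : Finset (Fin 3 → ℤ), unitStock ⊆ S → ∀ (a E ε : ℝ), 0 < a → 0 < ε →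
      loud S a E ε ⊆ closure (tameLeaf S a (2 * E) (ε / 2) ∪ simpleSteady S a (2 * E) (ε / 2)) := by
  sorry

/-! ## §3 Glue of v5 (sorry-free modulo the stubs): the new class is tame -/

/-- A point `(c, x)` with `|x| < r` lies in the ball of radius `r` around `(c, 0)` (sup metric). [folklore] -/
theorem mk_mem_ball {S : Finset (Fin 3 → ℤ)} (c : Coeff S) {x r : ℝ} (hx : |x| < r) :
    (c, x) ∈ Metric.ball (c, (0 : ℝ)) r := by
  rw [Metric.mem_ball, Prod.dist_eq, dist_self, Real.dist_eq, sub_zero]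
  exact max_lt (lt_of_le_of_lt (abs_nonneg x) hx) hx

/-- **`simpleSteady ⊆ familySteady`** (from `stub_borderedFamily`): the strict budgets of `u₀` leave a Peter–Paul slack
absorbing an `H¹`-perturbation of squared size `δ` (pattern of `mem_borderedSteady_of_malkin`), and ISOLATION of `u₀` forces
`σ(c, x) ≠ 0` for every small `x ≠ 0` (else the corrected force is `f_c` itself and carries the steady state `υ ≠ u₀` within
the isolation radius). [folklore] -/
theorem simpleSteady_subset_familySteady (S : Finset (Fin 3 → ℤ)) (a E ε : ℝ) :
    simpleSteady S a E ε ⊆ familySteady S a E ε := by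
  intro c hc
  obtain ⟨ν, hν, hνa, u₀, p₀, hst, h0, hE, hε, ⟨ρ, hρ, hiso⟩, v, d, hv₁, hv₂, hv₃, hker, hvis⟩ := hc
  obtain ⟨σ, hσ0, hwin⟩ := stub_borderedFamily S c d ν u₀ p₀ v hν hst h0 hv₁ hv₂ hv₃ hker hvis
  have hsm₀ : IsSmooth u₀ := hst.smooth_velocity.isSmooth_slice (Set.mem_univ (0 : ℝ))
  -- the budgets of `u₀`, as integrals over `T³`
  set A₀ : ℝ := ∫ x, ‖u₀ x‖ ^ 2 with hA₀
  set G₀ : ℝ := gradNormSq u₀ with hG₀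
  have hA : A₀ < E := by rwa [SteadyWindow.meanEnergy_const] at hE
  have hG : ε < ν * G₀ := by rwa [SteadyWindow.meanDissipation_const ν hsm₀] at hε
  -- slack: `η > 0` with `(1+η)A₀ < E`, `(1+η)ε < νG₀`
  obtain ⟨η, ⟨hηE, hηε⟩, hη0⟩ :
      ∃ η : ℝ, ((1 + η) * A₀ < E ∧ (1 + η) * ε < ν * G₀) ∧ 0 < η := by
    have h1 : ∀ᶠ η : ℝ in 𝓝 0, (1 + η) * A₀ < E :=
      Filter.Tendsto.eventually_lt_const (v := (1 + 0) * A₀) (by simpa using hA)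
        (((continuous_const.add continuous_id).mul continuous_const).tendsto' _ _ rfl)
    have h2 : ∀ᶠ η : ℝ in 𝓝 0, (1 + η) * ε < ν * G₀ :=
      Filter.Tendsto.eventually_lt_const (v := (1 + 0) * ε) (by simpa using hG)
        (((continuous_const.add continuous_id).mul continuous_const).tendsto' _ _ rfl)
    exact (((h1.and h2).filter_mono nhdsWithin_le_nhds).and
      (self_mem_nhdsWithin : Set.Ioi (0 : ℝ) ∈ 𝓝[>] (0 : ℝ))).exists
  -- then `δ > 0` absorbing the `H¹`-perturbation
  obtain ⟨δ, ⟨hδE, hδε⟩, hδ0⟩ : ∃ δ : ℝ, ((1 + η) * A₀ + (1 + η⁻¹) * δ < E ∧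
      (1 + η) * ε + ν * ((1 + η⁻¹) * δ) < ν * G₀) ∧ 0 < δ := by
    have h1 : ∀ᶠ δ : ℝ in 𝓝 0, (1 + η) * A₀ + (1 + η⁻¹) * δ < E :=
      Filter.Tendsto.eventually_lt_const (v := (1 + η) * A₀ + (1 + η⁻¹) * 0) (by simpa using hηE)
        ((continuous_const.add (continuous_const.mul continuous_id)).tendsto' _ _ rfl)
    have h2 : ∀ᶠ δ : ℝ in 𝓝 0, (1 + η) * ε + ν * ((1 + η⁻¹) * δ) < ν * G₀ :=
      Filter.Tendsto.eventually_lt_const (v := (1 + η) * ε + ν * ((1 + η⁻¹) * 0))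
        (by simpa using hηε)
        ((continuous_const.add
          (continuous_const.mul (continuous_const.mul continuous_id))).tendsto' _ _ rfl)
    exact (((h1.and h2).filter_mono nhdsWithin_le_nhds).and
      (self_mem_nhdsWithin : Set.Ioi (0 : ℝ) ∈ 𝓝[>] (0 : ℝ))).exists
  -- the bordered family for `δ₁ = min δ ρ`
  obtain ⟨r, hr, hcont, hball⟩ := hwin (min δ ρ) (lt_min hδ0 hρ)
  refine ⟨ν, hν, hνa, d, σ, r, hσ0, hr, hcont, fun q hq => ?_, fun θ hθ => ?_⟩
  · obtain ⟨u', p', hst', -, hdist, -⟩ := hball q hq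
    have hsm' : IsSmooth u' := hst'.smooth_velocity.isSmooth_slice (Set.mem_univ (0 : ℝ))
    have hL2 : 0 ≤ ∫ x, ‖u' x - u₀ x‖ ^ 2 := integral_nonneg fun _ => sq_nonneg _
    have hH1 : 0 ≤ gradNormSq (fun x => u' x - u₀ x) := gradNormSq_nonneg _
    have hdist' : (∫ x, ‖u' x - u₀ x‖ ^ 2) + gradNormSq (fun x => u' x - u₀ x) < min δ ρ := hdist
    have hmin : min δ ρ ≤ δ := min_le_left _ _
    have hdL : ∫ x, ‖u' x - u₀ x‖ ^ 2 ≤ δ := by linarith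
    have hdG : gradNormSq (fun x => u' x - u₀ x) ≤ δ := by linarith
    have hη1 : 0 ≤ 1 + η⁻¹ := by positivity
    refine ⟨u', p', hst', ?_, ?_⟩
    · rw [SteadyWindow.meanEnergy_const]
      have h := SteadyWindow.integral_norm_sq_le hsm₀.continuous hsm'.continuous hη0
      have : (1 + η⁻¹) * ∫ x, ‖u' x - u₀ x‖ ^ 2 ≤ (1 + η⁻¹) * δ :=
        mul_le_mul_of_nonneg_left hdL hη1
      linarith
    · rw [SteadyWindow.meanDissipation_const ν hsm']
      have h := SteadyWindow.gradNormSq_le hsm₀ hsm' hη0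
      have h1 : (1 + η⁻¹) * gradNormSq (fun x => u' x - u₀ x) ≤ (1 + η⁻¹) * δ :=
        mul_le_mul_of_nonneg_left hdG hη1
      have h2 : ν * G₀ ≤ ν * ((1 + η) * gradNormSq u' + (1 + η⁻¹) * δ) :=
        mul_le_mul_of_nonneg_left (by linarith) hν.le
      have h3 : (1 + η) * ε < (1 + η) * (ν * gradNormSq u') := by nlinarith
      exact (lt_of_mul_lt_mul_left h3 (by linarith)).le
  · -- non-constancy of `x ↦ σ(c, x)` from isolation
    set x : ℝ := min (θ / 2) (r / 2) with hx
    have hx0 : 0 < x := lt_min (by linarith) (by linarith)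
    have hxθ : |x| < θ := by
      rw [abs_of_pos hx0]; exact (min_le_left _ _).trans_lt (by linarith)
    have hxr : |x| < r := by
      rw [abs_of_pos hx0]; exact (min_le_right _ _).trans_lt (by linarith)
    refine ⟨x, hxθ, fun hσx => ?_⟩
    obtain ⟨u', p', hst', hm', hdist, hne⟩ := hball (c, x) (mk_mem_ball c hxr)
    have hst'' : Torus.IsSteadyNSState ν (force S c) u' p' := by
      have e : ((c, x) : Coeff S × ℝ).1 - σ (c, x) • d = c := by rw [hσx, zero_smul, sub_zero]
      rwa [e] at hst'
    have hdρ : h1DistSq u' u₀ < ρ := lt_of_lt_of_le hdist (min_le_right _ _)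
    exact hne hx0.ne' (hiso u' p' hst'' hm' hdρ)

/-- **`familySteady ⊆ closure (interior LOUD)`** (from `stub_familyBand`): the corrected forces carry classical steady states
with budgets, i.e. loud witnesses (`BorderedCone.mem_loud_of_steady`), and the band engine concludes. [folklore] -/
theorem familySteady_subset_closure_interior_loud (S : Finset (Fin 3 → ℤ)) (a E ε : ℝ) :
    familySteady S a E ε ⊆ closure (interior (loud S a E ε)) := by
  intro c hc
  obtain ⟨ν, hν, hνa, d, σ, r₀, hσ0, hr₀, hcont, hgood, hnc⟩ := hc
  refine stub_familyBand S (loud S a E ε) c d σ r₀ hr₀ hσ0 hcont (fun q hq => ?_) hnc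
  obtain ⟨u', p', hst', hE', hε'⟩ := hgood q hq
  exact BorderedCone.mem_loud_of_steady hν hνa hst' hE' hε'

/-- **The new class is tame**: `simpleSteady ⊆ closure (interior LOUD)` at the same strict budgets. [folklore] -/
theorem simpleSteady_subset_closure_interior_loud (S : Finset (Fin 3 → ℤ)) (a E ε : ℝ) :
    simpleSteady S a E ε ⊆ closure (interior (loud S a E ε)) :=
  (simpleSteady_subset_familySteady S a E ε).trans (familySteady_subset_closure_interior_loud S a E ε)

/-! ## §4 Composition (sorry-free modulo the stubs): the landed upgrade theorems + v5 prove the crux BY NAME -/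

/-- **Every tame witness class of v4 is force-open up to closure** (the six LANDED upgrade theorems). [folklore] -/
theorem tameLeaf_subset_closure_interior_loud (S : Finset (Fin 3 → ℤ)) (a E ε : ℝ) :
    tameLeaf S a E ε ⊆ closure (interior (loud S a E ε)) :=
  tameLeaf_subset_closure_interior SteadyPersistLeaf.stub_steadyPersistLeaf SteadyWindowLeaf.stub_steadyWindowLeaf
    CensusInterior.stub_censusInterior MalkinBordered.stub_malkinBordered BorderedCone.stub_borderedCone
    PeriodicWindow.stub_periodicWindow S a E ε

/-- **Composition engine of v5** (pure topology): if both summands of the v5 tame union lie in `closure (interior LOUD)` at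
budgets `(2E, ε/2)` and the residual holds, the crux follows with `S₀ := unitStock`. [folklore] -/
theorem RobustLoudUpgrade_of_v5
    (hT : ∀ (S : Finset (Fin 3 → ℤ)) (a E ε : ℝ), tameLeaf S a E ε ⊆ closure (interior (loud S a E ε)))
    (hN : ∀ (S : Finset (Fin 3 → ℤ)) (a E ε : ℝ), simpleSteady S a E ε ⊆ closure (interior (loud S a E ε)))
    (h₅ : ∀ S : Finset (Fin 3 → ℤ), unitStock ⊆ S → ∀ (a E ε : ℝ), 0 < a → 0 < ε →
      loud S a E ε ⊆ closure (tameLeaf S a (2 * E) (ε / 2) ∪ simpleSteady S a (2 * E) (ε / 2))) :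
    RobustLoudUpgrade := by
  refine ⟨unitStock, fun S hS E ε hε j => ?_⟩
  have ha : (0 : ℝ) < 1 / ((j : ℝ) + 1) := by positivity
  intro c hc
  have hcl := h₅ S hS (1 / ((j : ℝ) + 1)) E ε ha hε hc
  have hsub : tameLeaf S (1 / ((j : ℝ) + 1)) (2 * E) (ε / 2) ∪ simpleSteady S (1 / ((j : ℝ) + 1)) (2 * E) (ε / 2) ⊆
      closure (interior (loud S (1 / ((j : ℝ) + 1)) (2 * E) (ε / 2))) :=
    Set.union_subset (hT S _ _ _) (hN S _ _ _)
  exact closure_minimal hsub isClosed_closure hcl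

/-- **The line closes the crux modulo its v5 stubs** (`stub_borderedFamily`, `stub_familyBand`, `stub_tameDenseSimple`;
everything else is a landed theorem). -/
theorem RobustLoudUpgrade_of_stubs :
    Summit.AnomalousDissipation.AnomalousDissipation.Theses.BaireTransfer.RobustLoudUpgrade :=
  RobustLoudUpgrade_of_v5 tameLeaf_subset_closure_interior_loud simpleSteady_subset_closure_interior_loud
    stub_tameDenseSimple

end Summit.AnomalousDissipation.AnomalousDissipation.Cruxes.RobustLoudUpgrade.MalkinConeGroupOrbits

end
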